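import Literature.NumberTheory.EllipticCurves.WeierstrassAutFixedTorsionProofs
import Literature.NumberTheory.EllipticCurves.TorsionCardinality
import HarnessLib

/-!
# Conjugate points under a field homomorphism; rigidity of Weierstrass automorphisms on `3`-torsion

`Proofs` file (theorems only; no definitions, no named facts, no instances) in topic
`NumberTheory/EllipticCurves`, companion of `VariableChangePoints` / `VariableChangePointsMap`
(the isomorphism `pointEquiv` of a change of variables), `WeierstrassAutFixedTorsionProofs` (a
non-trivial Weierstrass automorphism fixes only `2`- and `3`-torsion) and `TorsionCardinality`
(`#E[n] = n²`). Written by the cell `abc-iut` (seat abc-iut-L5-t12) as the elementary input of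
[IUTchI] Remark 3.1.5 (`K = F(E[l])` is Galois over the field of moduli; the twist argument of
[IUTchIV] Prop. 1.8 (iv)), but stated for arbitrary Weierstrass equations:

* `WeierstrassCurve.exists_pointHom_map` — for a ring homomorphism of FIELDS `σ : L → L'` the map
  `(x, y) ↦ (σ x, σ y)` is a group homomorphism `W(L) → W^σ(L')` onto the points of the conjugate
  equation `W^σ = W.map σ` (Silverman, *AEC*, III.2.3: the group law is given by universal formulas
  in the coefficients; Mathlib's `Affine.Point.map` is the special case of an algebra homomorphism
  over the field of definition of `W`), and `exists_eq_pointHom_of_ringEquiv`: for a ring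
  ISOMORPHISM it is onto.
* `WeierstrassCurve.VariableChange.eq_one_of_three_torsion_fixed` — in characteristic `∤ 6`, a
  change of variables `A` with `A • V = V` whose automorphism of `V(k)` fixes a point `Q₁ ≠ O` with
  `3•Q₁ = O` and a point `Q₂ ∉ {O, ±Q₁}` is `A = 1` (Silverman, *AEC*, III.10.1: `Aut = μ₂, μ₄, μ₆`;
  here via the tree's analysis: `u = 1` forces `A = 1`, `u = −1` is the negation, `u² ≠ 1` pins
  the abscissa of every fixed point).
* `WeierstrassCurve.exists_three_torsion_pair` — over an algebraically closed field with `3 ≠ 0`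
  an elliptic curve has such a pair `Q₁, Q₂` of `3`-torsion points (`#E[3] = 9 > 3`, *AEC* III.6.4).

Together: an automorphism of an elliptic curve over an algebraically closed field of
characteristic `∤ 6` fixing `E[3]` pointwise is the identity (only this consequence of
*AEC* III.10.1 is proved).

## References

* [SilvermanAEC2009] J. H. Silverman, *The Arithmetic of Elliptic Curves*, 2nd ed., GTM 106
  (2009): III.1 Table 3.1, Group Law Algorithm III.2.3, Cor. III.6.4(b), Thm. III.10.1.

## Design

Pure theorems; `open scoped Classical` (the group law on `Affine.Point` uses the classical
`DecidableEq`, as in `GaloisAction.lean` / `TorsionCardinality.lean`); deliberate dot-notation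
extensions of Mathlib's `WeierstrassCurve` namespace as in the companion files. Axioms:
`propext`, `Classical.choice`, `Quot.sound`.
-/

noncomputable section

open scoped Classical

universe u v

namespace WeierstrassCurve

open Literature.NumberTheory.EllipticCurves

/-! ## §1. Points under an automorphism of the field of definition of the points -/

section PointMap

variable {L : Type u} {L' : Type v} [Field L] [Field L'] (W : WeierstrassCurve L) (σ : L →+* L')

/-- **Transport of points along a ring homomorphism of the coordinate field.** For a Weierstrass
equation `W` over a field `L` and a ring homomorphism `σ : L → L'` of fields there is a group
homomorphism `σ̃ : W(L) → W^σ(L')`, `W^σ := W.map σ` the conjugate equation, given on affine points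
by `(x, y) ↦ (σ x, σ y)` (the group law is given by universal formulas in the coefficients;
Mathlib's `Affine.Point.map` is the case of an algebra homomorphism over the field of definition of
`W`). Silverman, *AEC*, III.2.3 (Group Law Algorithm), with VIII.§1 (`P ↦ P^σ`).
[cite: SilvermanAEC2009, III.2.3 (Group Law Algorithm)] -/
theorem exists_pointHom_map :
    ∃ f : W.toAffine.Point →+ (W.map σ).toAffine.Point,
      ∀ {x y : L} (h : W.toAffine.Nonsingular x y),
        f (.some x y h) = .some (σ x) (σ y) ((Affine.map_nonsingular _ σ.injective x y).mpr h) := by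
  let g : W.toAffine.Point → (W.map σ).toAffine.Point := fun P => match P with
    | .zero => 0
    | .some x y h => .some (σ x) (σ y) ((Affine.map_nonsingular _ σ.injective x y).mpr h)
  have hg0 : g 0 = 0 := rfl
  have hgs : ∀ {x y : L} (h : W.toAffine.Nonsingular x y),
      g (.some x y h) = .some (σ x) (σ y) ((Affine.map_nonsingular _ σ.injective x y).mpr h) :=
    fun _ => rfl
  suffices hadd : ∀ P Q, g (P + Q) = g P + g Q from ⟨AddMonoidHom.mk' g hadd, fun h => rfl⟩
  rintro (_ | ⟨x₁, y₁, h₁⟩) (_ | ⟨x₂, y₂, h₂⟩)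
  any_goals rfl
  by_cases hxy : x₁ = x₂ ∧ y₁ = W.toAffine.negY x₂ y₂
  · have hxy' : σ x₁ = σ x₂ ∧ σ y₁ = (W.map σ).toAffine.negY (σ x₂) (σ y₂) := by
      refine ⟨congr_arg σ hxy.1, ?_⟩
      rw [hxy.2]
      exact (Affine.map_negY σ x₂ y₂).symm
    rw [Affine.Point.add_of_Y_eq hxy.1 hxy.2, hg0, hgs h₁, hgs h₂,
      Affine.Point.add_of_Y_eq hxy'.1 hxy'.2]
  · have hxy' : ¬(σ x₁ = σ x₂ ∧ σ y₁ = (W.map σ).toAffine.negY (σ x₂) (σ y₂)) := by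
      rintro ⟨hx, hy⟩
      refine hxy ⟨σ.injective hx, σ.injective ?_⟩
      rw [hy]
      exact Affine.map_negY σ x₂ y₂
    rw [Affine.Point.add_some hxy, hgs h₁, hgs h₂, Affine.Point.add_some hxy']
    simp only [hgs, Affine.map_slope, Affine.map_addX, Affine.map_addY]

/-- The transport `σ̃` along a ring ISOMORPHISM `σ` of the coordinate field is surjective: every
point of `W^σ` is `σ̃` of a point of `W` (Silverman, *AEC*, III.2.3 with VIII.§1).
[cite: SilvermanAEC2009, III.2.3 (Group Law Algorithm)] -/
theorem exists_eq_pointHom_of_ringEquiv (σ : L ≃+* L')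
    (f : W.toAffine.Point →+ (W.map (σ : L →+* L')).toAffine.Point)
    (hf : ∀ {x y : L} (h : W.toAffine.Nonsingular x y),
      f (.some x y h) = .some (σ x) (σ y)
        ((Affine.map_nonsingular _ (σ : L →+* L').injective x y).mpr h))
    (Q : (W.map (σ : L →+* L')).toAffine.Point) : ∃ P, f P = Q := by
  rcases Q with _ | ⟨x', y', h'⟩
  · exact ⟨0, by rw [map_zero]; rfl⟩
  · have h : W.toAffine.Nonsingular (σ.symm x') (σ.symm y') := by
      rw [← Affine.map_nonsingular _ (σ : L →+* L').injective]
      simpa using h'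
    refine ⟨.some _ _ h, ?_⟩
    rw [hf]
    simp only [RingEquiv.apply_symm_apply]

end PointMap

/-! ## §2. A Weierstrass automorphism fixing two independent `3`-torsion points is the identity -/

section Rigidity

variable {k : Type u} [Field k] (V : WeierstrassCurve k)

/-- **Rigidity of Weierstrass automorphisms on `3`-torsion** (characteristic `∤ 6`). Let
`A • V = V` be a change of coordinates preserving the equation, and suppose the induced
automorphism of `V(k)` fixes a point `Q₁ ≠ O` with `3•Q₁ = O` and a second point
`Q₂ ∉ {O, Q₁, −Q₁}`. Then `A = 1`. Proof: write `μ = u⁻¹`; if `μ² ≠ 1` the abscissa of every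
affine fixed point equals `μ²r/(μ² − 1)`, so two fixed affine points are equal or opposite; if
`μ = −1` the automorphism is `−1` (tree: `map_eq_neg_of_smul_eq_of_u_eq_neg_one`), so `Q₁ = −Q₁`
is `2`-torsion and `3`-torsion, i.e. `O`; if `μ = 1` then `A = 1`
(tree: `eq_one_of_smul_eq_of_u_eq_one`). Silverman, *AEC*, III.10.1 (`Aut = μ₂, μ₄, μ₆` in
characteristic `∤ 6`) — only this consequence is proved.
[cite: SilvermanAEC2009, III.10 Thm. 10.1 and III.1 Table 3.1] -/
theorem VariableChange.eq_one_of_three_torsion_fixed (h2 : (2 : k) ≠ 0) (h3 : (3 : k) ≠ 0)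
    {A : VariableChange k} (hA : A • V = V) {Q₁ Q₂ : V.toAffine.Point} (h3Q : 3 • Q₁ = 0)
    (h₁ : Q₁ ≠ 0) (h₂ : Q₂ ≠ 0) (hne : Q₂ ≠ Q₁) (hne' : Q₂ ≠ -Q₁)
    (hfix₁ : Affine.Point.congrEquiv hA (VariableChange.pointEquiv V A Q₁) = Q₁)
    (hfix₂ : Affine.Point.congrEquiv hA (VariableChange.pointEquiv V A Q₂) = Q₂) : A = 1 := by
  by_contra hA1
  set μ : k := ((A.u⁻¹ : kˣ) : k) with hμ
  by_cases hμ2 : μ ^ 2 = 1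
  · have hμ1 : μ = 1 ∨ μ = -1 := mul_self_eq_one_iff.mp (by rw [← sq]; exact hμ2)
    rcases hμ1 with h1 | h1
    · apply hA1
      have hu : A.u = 1 := by
        have : (A.u⁻¹ : kˣ) = 1 := Units.ext (by rw [← hμ, h1, Units.val_one])
        simpa using this
      exact VariableChange.eq_one_of_smul_eq_of_u_eq_one V h2 h3 hA hu
    · have hu : A.u = -1 := by
        have : (A.u⁻¹ : kˣ) = -1 := Units.ext (by rw [← hμ, h1, Units.val_neg, Units.val_one])
        rw [inv_eq_iff_eq_inv] at this
        rw [this, inv_neg, inv_one]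
      have hneg := VariableChange.map_eq_neg_of_smul_eq_of_u_eq_neg_one V h2 h3 hA hu Q₁
      rw [hfix₁] at hneg
      -- `Q₁ = -Q₁`, so `2 • Q₁ = 0`; with `3 • Q₁ = 0` this forces `Q₁ = 0`
      have h2Q : 2 • Q₁ = 0 := by
        rw [two_nsmul]
        nth_rw 2 [hneg]
        exact add_neg_cancel Q₁
      apply h₁
      calc Q₁ = 3 • Q₁ - 2 • Q₁ := by
            rw [show (3 : ℕ) = 2 + 1 from rfl, succ_nsmul, add_sub_cancel_left]
        _ = 0 := by rw [h3Q, h2Q, sub_zero]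
  · have h12 : μ ^ 2 - 1 ≠ 0 := sub_ne_zero.mpr hμ2
    rcases Q₁ with _ | ⟨x₁, y₁, hQ₁⟩
    · exact h₁ rfl
    rcases Q₂ with _ | ⟨x₂, y₂, hQ₂⟩
    · exact h₂ rfl
    rw [VariableChange.pointEquiv_some, Affine.Point.congrEquiv_some, Affine.Point.some.injEq]
      at hfix₁ hfix₂
    have e₁ : μ ^ 2 * (x₁ - A.r) = x₁ := by rw [hμ, ← VariableChange.toX_def]; exact hfix₁.1
    have e₂ : μ ^ 2 * (x₂ - A.r) = x₂ := by rw [hμ, ← VariableChange.toX_def]; exact hfix₂.1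
    have hxx : x₂ = x₁ := by
      have f₁ : (μ ^ 2 - 1) * x₁ = μ ^ 2 * A.r := by linear_combination e₁
      have f₂ : (μ ^ 2 - 1) * x₂ = μ ^ 2 * A.r := by linear_combination e₂
      exact mul_left_cancel₀ h12 (f₂.trans f₁.symm)
    rcases Affine.Y_eq_of_X_eq hQ₂.left hQ₁.left hxx with hyy | hyy
    · exact hne (by simp only [hxx, hyy])
    · exact hne' (by rw [Affine.Point.neg_some]; simp only [hxx, hyy])

/-- Over an algebraically closed field in which `3 ≠ 0`, an elliptic curve has two `3`-torsion
points `Q₁ ≠ O` and `Q₂ ∉ {O, Q₁, −Q₁}` — because `#E[3] = 9 > 3` (the tree's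
`card_torsionBy_eq_sq`, Silverman *AEC* III.6.4(b)). [cite: SilvermanAEC2009, Cor. III.6.4(b)] -/
theorem exists_three_torsion_pair [IsAlgClosed k] [V.IsElliptic] (h3 : (3 : k) ≠ 0) :
    ∃ Q₁ Q₂ : V.toAffine.Point, 3 • Q₁ = 0 ∧ 3 • Q₂ = 0 ∧ Q₁ ≠ 0 ∧ Q₂ ≠ 0 ∧ Q₂ ≠ Q₁ ∧
      Q₂ ≠ -Q₁ := by
  have hcard : Nat.card (AddSubgroup.torsionBy V.toAffine.Point ((3 : ℕ) : ℤ)) = 3 ^ 2 :=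
    card_torsionBy_eq_sq (E := V) (n := 3) (by exact_mod_cast h3)
  set s : Set V.toAffine.Point := {P | 3 • P = 0} with hs_def
  have hmem : ∀ P, P ∈ (AddSubgroup.torsionBy V.toAffine.Point ((3 : ℕ) : ℤ) : Set _) ↔ P ∈ s := by
    intro P
    rw [hs_def, Set.mem_setOf_eq, SetLike.mem_coe, AddSubgroup.torsionBy.nsmul_iff]
  have hset : (AddSubgroup.torsionBy V.toAffine.Point ((3 : ℕ) : ℤ) : Set _) = s :=
    Set.ext hmem
  have hs : s.ncard = 9 := by
    rw [← hset, ← Nat.card_coe_set_eq]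
    exact hcard
  have hsfin : s.Finite := Set.finite_of_ncard_pos (by rw [hs]; norm_num)
  -- a first non-zero `3`-torsion point
  obtain ⟨Q₁, hQ₁s, hQ₁0⟩ : ∃ Q₁ ∈ s, Q₁ ∉ ({0} : Set V.toAffine.Point) := by
    by_contra hcon
    push Not at hcon
    have hle : s.ncard ≤ ({0} : Set V.toAffine.Point).ncard :=
      Set.ncard_le_ncard hcon (Set.finite_singleton _)
    rw [hs, Set.ncard_singleton] at hle
    omega
  -- a second one outside `{0, Q₁, -Q₁}`
  obtain ⟨Q₂, hQ₂s, hQ₂0⟩ : ∃ Q₂ ∈ s, Q₂ ∉ ({0, Q₁, -Q₁} : Set V.toAffine.Point) := by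
    by_contra hcon
    push Not at hcon
    have hfin : ({0, Q₁, -Q₁} : Set V.toAffine.Point).Finite := by
      exact Set.toFinite _
    have hle : s.ncard ≤ ({0, Q₁, -Q₁} : Set V.toAffine.Point).ncard := Set.ncard_le_ncard hcon hfin
    have h3' : ({0, Q₁, -Q₁} : Set V.toAffine.Point).ncard ≤ 3 := by
      refine (Set.ncard_insert_le _ _).trans ?_
      refine (Nat.add_le_add_right (Set.ncard_insert_le _ _) 1).trans ?_
      rw [Set.ncard_singleton]
    rw [hs] at hle
    omega
  simp only [Set.mem_singleton_iff] at hQ₁0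
  simp only [Set.mem_insert_iff, Set.mem_singleton_iff, not_or] at hQ₂0
  exact ⟨Q₁, Q₂, hQ₁s, hQ₂s, hQ₁0, hQ₂0.1, hQ₂0.2.1, hQ₂0.2.2⟩

end Rigidity

end WeierstrassCurve
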